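import Summits.SmoothPoincare4.SmoothPoincare4.Theorems.CylinderEntropyImmortalAreaToFloorParameterTerms
import HarnessLib

/-!
# Route `CylinderEntropy`, item `ImmortalAreaToFloor` (stmt-SmoothPoincare4-17197):
# the choice of the parameters of the stacking argument (module Γ6/Γ8 of `BLUEPRINT-17197-c2.md`,
# pure real arithmetic, part 2)

The stacking contradiction `noTwoGoodPoints` needs, for the gap `g` of two good points on one
vertical, scales `σ₀ = g²/C₀² ≤ σ₁ = Λ₁ g²`, a near radius `ρ = K_ρ g ≤ R₀`, an aperture `η`, an
AM–GM parameter `κ`, a tilt threshold `ξ`, a Willmore threshold `θ` and a Willmore budget `W ≤ W₀`,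
satisfying four numeric smallness conditions in which every contribution is either scale-free
(proportional to `ξ`, `1/κ`, `e^{-K_ρ²/(8Λ₁)}`, `e^{-K_ρ²/(16Λ₁)}`) or carries a positive power of `g`.
`exists_stackingParameters` chooses them in the order
`δ₀ ↦ (η, Λ₁) ↦ C₀² ↦ K_ρ ↦ κ ↦ ξ ↦ g_max`, `θ = π²/(4096 e^{1/16}(C_A+1))`, `W₀ = R₀⁴/2`
(so that `K_H = 2048 e^{1/16} θ C_A/π² + W/R₀⁴ ≤ 1`), polynomially, and verifies the conditions for
all `0 < g ≤ g_max`, `0 ≤ W ≤ W₀` using the term-by-term lemmas `param_hm`, `param_ha`, `param_hK`.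

References: W. K. Allard, Ann. of Math. 95 (1972) §6 (the order of constants in the integrality
theorem); L. Simon, *Lectures on GMT* (1983) §17.
-/

-- the prescribed namespace `Summit.SmoothPoincare4.SmoothPoincare4.…` repeats `SmoothPoincare4`
set_option linter.dupNamespace false

noncomputable section

open Real

namespace Summit.SmoothPoincare4.SmoothPoincare4.Cruxes.CylinderRungTwo.KillingFlux

/-- **The parameters of the stacking argument.**  See the module docstring: given the gap
`δ₀ ∈ (0,1]`, the maximal comparison scale `τ_max`, the goodness radius `R₀`, the Ahlfors constant
`C_A`, the Gaussian mass constant `C_G`, the cutoff constants `c₁, c₂` and a wish `ξ₁` for the tilt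
threshold, there are `η, Λ₁, C₀², K_ρ, κ, ξ ≤ min(ξ₁, 1/2), θ, W₀, g_max > 0` such that for all
`0 < g ≤ g_max` and `0 ≤ W ≤ W₀` the scales `σ₀ = g²/C₀² ≤ σ₁ = Λ₁ g²`, `ρ = K_ρ g ≤ R₀`,
`(1+η)σ₁ ≤ τ_max` satisfy the four numeric hypotheses `hm, hE, ha, hK` of `noTwoGoodPoints`.
[cite: Allard1972, §6] -/
theorem exists_stackingParameters {δ₀ τmax R₀ CA CG c₁ c₂ ξ₁ : ℝ} (hδ₀ : 0 < δ₀) (hδ₁ : δ₀ ≤ 1)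
    (hτ : 0 < τmax) (hR₀ : 0 < R₀) (hCA : 0 ≤ CA) (hCG : 0 ≤ CG) (hc₁ : 0 ≤ c₁) (hc₂ : 0 ≤ c₂)
    (hξ₁ : 0 < ξ₁) :
    ∃ η Λ₁ C₀sq Kρ κ ξ θ W₀ gmax : ℝ, 0 < η ∧ 0 < Λ₁ ∧ 0 < C₀sq ∧ 0 < Kρ ∧ 0 < κ ∧ 0 < ξ ∧ ξ ≤ ξ₁ ∧
      ξ ≤ 1 / 2 ∧ 0 < θ ∧ 0 < W₀ ∧ 0 < gmax ∧
      ∀ g W : ℝ, 0 < g → g ≤ gmax → 0 ≤ W → W ≤ W₀ →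
        g ^ 2 / C₀sq ≤ Λ₁ * g ^ 2 ∧ Kρ * g ≤ R₀ ∧ (1 + η) * (Λ₁ * g ^ 2) ≤ τmax ∧
        (1 - δ₀ / 8 ≤ (1 + η)⁻¹ ^ 2 *
          Real.exp (-((1 + η⁻¹) * (g / 2) ^ 2) / (4 * ((1 + η) * (Λ₁ * g ^ 2))))) ∧
        (1 - δ₀ / 16 ≤ Real.exp (-(4 * (Λ₁ * g ^ 2)))) ∧
        (Real.exp (4 * (g ^ 2 / C₀sq)) *
            ((2048 * Real.exp (1 / 16) * (θ * CA) / Real.pi ^ 2 + W / R₀ ^ 4) / 4) * (g ^ 2 / C₀sq) +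
          4 * Real.exp (4 * (g ^ 2 / C₀sq)) * Real.exp (-g ^ 2 / (72 * (g ^ 2 / C₀sq))) * CG ≤ δ₀ / 16) ∧
        (((2048 * Real.exp (1 / 16) * (θ * CA) / Real.pi ^ 2 + W / R₀ ^ 4) / 4
          + c₂ / g ^ 2 *
            ((1 / (4 * Real.pi * (g ^ 2 / C₀sq)) ^ 2) * (ξ * (CA * (Kρ * g) ^ 4)) +
              4 * Real.exp (-(Kρ * g) ^ 2 / (8 * (Λ₁ * g ^ 2))) * CG)
          + c₁ / g *
            ((1 / 2) * (2048 * Real.exp (1 / 16) * (θ * CA) / Real.pi ^ 2 + W / R₀ ^ 4) + (1 / (2 * 1)) * CG)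
          + (1 / (g ^ 2 / C₀sq)) * (c₁ / g *
            ((1 / (4 * Real.pi * (g ^ 2 / C₀sq)) ^ 2) * (Kρ * g) *
                ((κ / 2) * (ξ * (CA * (Kρ * g) ^ 4)) + CA * (Kρ * g) ^ 4 / (2 * κ))
              + 32 * Real.sqrt (Λ₁ * g ^ 2) * Real.exp (-(1 / 2)) *
                Real.exp (-(Kρ * g) ^ 2 / (16 * (Λ₁ * g ^ 2))) * CG)))
          * (Λ₁ * g ^ 2) ≤ δ₀ / 16) := by
  have hπ := Real.pi_pos
  -- the constants
  obtain ⟨η, hη⟩ : ∃ η : ℝ, η = δ₀ / 64 := ⟨_, rfl⟩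
  obtain ⟨Λ₁, hΛ₁⟩ : ∃ Λ₁ : ℝ, Λ₁ = 256 / δ₀ ^ 2 := ⟨_, rfl⟩
  obtain ⟨C₀sq, hC₀sq⟩ : ∃ C₀sq : ℝ, C₀sq = 1 + 27648 * (CG + 1) / δ₀ := ⟨_, rfl⟩
  obtain ⟨Kρ, hKρ⟩ : ∃ Kρ : ℝ, Kρ = 1 + 112 * 32 * c₂ * CG * Λ₁ ^ 2 / δ₀ +
    112 * 512 * c₁ * C₀sq * (16 / δ₀) * Λ₁ ^ 2 * CG / δ₀ := ⟨_, rfl⟩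
  obtain ⟨κ, hκ⟩ : ∃ κ : ℝ, κ = 1 + 4 * c₁ * C₀sq ^ 3 * Kρ ^ 5 * CA * Λ₁ / δ₀ := ⟨_, rfl⟩
  obtain ⟨Dξ, hDξ⟩ : ∃ Dξ : ℝ, Dξ = 2 + 1 / ξ₁ + 16 * c₂ * C₀sq ^ 2 * CA * Kρ ^ 4 * Λ₁ / δ₀ +
    4 * c₁ * C₀sq ^ 3 * Kρ ^ 5 * CA * Λ₁ * κ / δ₀ := ⟨_, rfl⟩
  obtain ⟨ξ, hξ⟩ : ∃ ξ : ℝ, ξ = 1 / Dξ := ⟨_, rfl⟩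
  obtain ⟨θ, hθ⟩ : ∃ θ : ℝ, θ = Real.pi ^ 2 / (4096 * Real.exp (1 / 16) * (CA + 1)) := ⟨_, rfl⟩
  obtain ⟨W₀, hW₀⟩ : ∃ W₀ : ℝ, W₀ = R₀ ^ 4 / 2 := ⟨_, rfl⟩
  obtain ⟨Dg, hDg⟩ : ∃ Dg : ℝ, Dg = 1 + Kρ / R₀ + 2 * Λ₁ / τmax + 64 * Λ₁ / δ₀ +
    128 * (c₁ + 1) * Λ₁ * (1 + CG) / δ₀ := ⟨_, rfl⟩
  obtain ⟨gmax, hgmax⟩ : ∃ gmax : ℝ, gmax = 1 / Dg := ⟨_, rfl⟩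
  -- signs and sizes of the constants
  have hη0 : 0 < η := by rw [hη]; positivity
  have hη1 : η ≤ 1 := by rw [hη]; linarith only [hδ₁]
  have hΛ₁0 : 0 < Λ₁ := by rw [hΛ₁]; positivity
  have hΛ₁ge : 256 ≤ Λ₁ := by
    rw [hΛ₁, le_div_iff₀ (by positivity)]; nlinarith only [hδ₀, hδ₁]
  have hp0 : (0 : ℝ) ≤ 27648 * (CG + 1) / δ₀ := by positivity
  have hC₀1 : 1 ≤ C₀sq := by rw [hC₀sq]; linarith only [hp0]
  have hC₀0 : 0 < C₀sq := by linarith only [hC₀1]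
  have hpa : (0 : ℝ) ≤ 112 * 32 * c₂ * CG * Λ₁ ^ 2 / δ₀ := by positivity
  have hpb : (0 : ℝ) ≤ 112 * 512 * c₁ * C₀sq * (16 / δ₀) * Λ₁ ^ 2 * CG / δ₀ := by positivity
  have hKρ1 : 1 ≤ Kρ := by rw [hKρ]; linarith only [hpa, hpb]
  have hKa : 112 * 32 * c₂ * CG * Λ₁ ^ 2 / δ₀ ≤ Kρ := by rw [hKρ]; linarith only [hpb]
  have hKb : 112 * 512 * c₁ * C₀sq * (16 / δ₀) * Λ₁ ^ 2 * CG / δ₀ ≤ Kρ := by rw [hKρ]; linarith only [hpa]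
  have hKρ0 : 0 < Kρ := by linarith only [hKρ1]
  have hpc : (0 : ℝ) ≤ 4 * c₁ * C₀sq ^ 3 * Kρ ^ 5 * CA * Λ₁ / δ₀ := by positivity
  have hκ1 : 1 ≤ κ := by rw [hκ]; linarith only [hpc]
  have hκa : 4 * c₁ * C₀sq ^ 3 * Kρ ^ 5 * CA * Λ₁ / δ₀ ≤ κ := by rw [hκ]; linarith only []
  have hκ0 : 0 < κ := by linarith only [hκ1]
  have hp1 : (0 : ℝ) ≤ 1 / ξ₁ := by positivity
  have hp2 : (0 : ℝ) ≤ 16 * c₂ * C₀sq ^ 2 * CA * Kρ ^ 4 * Λ₁ / δ₀ := by positivity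
  have hp3 : (0 : ℝ) ≤ 4 * c₁ * C₀sq ^ 3 * Kρ ^ 5 * CA * Λ₁ * κ / δ₀ := by positivity
  have hDξ2 : 2 ≤ Dξ := by rw [hDξ]; linarith only [hp1, hp2, hp3]
  have hDξ0 : 0 < Dξ := by linarith only [hDξ2]
  have hξ0 : 0 < ξ := by rw [hξ]; positivity
  have hξD : ξ * Dξ = 1 := by rw [hξ]; field_simp
  have hθ0 : 0 < θ := by rw [hθ]; positivity
  have hW₀0 : 0 < W₀ := by rw [hW₀]; positivity
  have hq1 : (0 : ℝ) ≤ Kρ / R₀ := by positivity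
  have hq2 : (0 : ℝ) ≤ 2 * Λ₁ / τmax := by positivity
  have hq3 : (0 : ℝ) ≤ 64 * Λ₁ / δ₀ := by positivity
  have hq4 : (0 : ℝ) ≤ 128 * (c₁ + 1) * Λ₁ * (1 + CG) / δ₀ := by positivity
  have hDg1 : 1 ≤ Dg := by rw [hDg]; linarith only [hq1, hq2, hq3, hq4]
  have hDg0 : 0 < Dg := by linarith only [hDg1]
  have hgmax0 : 0 < gmax := by rw [hgmax]; positivity
  have hgD : gmax * Dg = 1 := by rw [hgmax]; field_simp
  -- `ξ ≤ 1/a` for each summand `a` of `Dξ`, `gmax ≤ 1/b` for each summand `b` of `Dg`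
  have hξle : ∀ a : ℝ, a ≤ Dξ → ξ * a ≤ 1 := fun a haD => by
    nlinarith only [hξD, haD, hξ0.le]
  have hgle' : ∀ b : ℝ, b ≤ Dg → gmax * b ≤ 1 := fun b hbD => by
    nlinarith only [hgD, hbD, hgmax0.le]
  have hξ₁' : ξ ≤ ξ₁ := by
    have h := hξle (1 / ξ₁) (by rw [hDξ]; linarith only [hp2, hp3])
    rw [mul_one_div, div_le_one hξ₁] at h
    exact h
  have hξhalf : ξ ≤ 1 / 2 := by
    have h := hξle 2 (by rw [hDξ]; linarith only [hp1, hp2, hp3])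
    linarith only [h]
  refine ⟨η, Λ₁, C₀sq, Kρ, κ, ξ, θ, W₀, gmax, hη0, hΛ₁0, hC₀0, hKρ0, hκ0, hξ0, hξ₁', hξhalf, hθ0, hW₀0,
    hgmax0, ?_⟩
  intro g W hg hgg hW hWW
  have hg0 : g ≠ 0 := hg.ne'
  -- `g ≤ gmax ≤ 1/b` for the summands `b` of `Dg`, and `g² ≤ g`
  have hgb : ∀ b : ℝ, 0 ≤ b → b ≤ Dg → g * b ≤ 1 := fun b hb hbD =>
    le_trans (mul_le_mul_of_nonneg_right hgg hb) (hgle' b hbD)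
  have hg1 : g ≤ 1 := by
    have := hgb 1 zero_le_one (by rw [hDg]; linarith only [hq1, hq2, hq3, hq4])
    linarith only [this]
  have hgsq : g ^ 2 ≤ g := by nlinarith only [hg, hg1]
  have hgR : g * (Kρ / R₀) ≤ 1 := hgb _ hq1 (by rw [hDg]; linarith only [hq2, hq3, hq4])
  have hgτ : g * (2 * Λ₁ / τmax) ≤ 1 := hgb _ hq2 (by rw [hDg]; linarith only [hq1, hq3, hq4])
  have hgδ : g * (64 * Λ₁ / δ₀) ≤ 1 := hgb _ hq3 (by rw [hDg]; linarith only [hq1, hq2, hq4])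
  have hgc : g * (128 * (c₁ + 1) * Λ₁ * (1 + CG) / δ₀) ≤ 1 :=
    hgb _ hq4 (by rw [hDg]; linarith only [hq1, hq2, hq3])
  -- consequences
  have hρR : Kρ * g ≤ R₀ := by
    have e : g * (Kρ / R₀) * R₀ = Kρ * g := by field_simp
    have := mul_le_mul_of_nonneg_right hgR hR₀.le
    rw [e, one_mul] at this
    exact this
  have hΛg : Λ₁ * g ^ 2 ≤ Λ₁ * g := mul_le_mul_of_nonneg_left hgsq hΛ₁0.le
  have hσ₁τ : (1 + η) * (Λ₁ * g ^ 2) ≤ τmax := by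
    have e : g * (2 * Λ₁ / τmax) * τmax = 2 * (Λ₁ * g) := by field_simp
    have h2 := mul_le_mul_of_nonneg_right hgτ hτ.le
    rw [e, one_mul] at h2
    have h3 : (1 + η) * (Λ₁ * g ^ 2) ≤ 2 * (Λ₁ * g ^ 2) :=
      mul_le_mul_of_nonneg_right (by linarith only [hη1]) (by positivity)
    linarith only [h2, h3, hΛg]
  have hσ₁δ : Λ₁ * g ^ 2 ≤ δ₀ / 64 := by
    have e : g * (64 * Λ₁ / δ₀) * δ₀ = 64 * (Λ₁ * g) := by field_simp
    have h2 := mul_le_mul_of_nonneg_right hgδ hδ₀.le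
    rw [e, one_mul] at h2
    linarith only [h2, hΛg]
  have hσ₀σ₁ : g ^ 2 / C₀sq ≤ Λ₁ * g ^ 2 := by
    rw [div_le_iff₀ hC₀0]
    have h1 : (1 : ℝ) ≤ Λ₁ * C₀sq := by nlinarith only [hΛ₁ge, hC₀1]
    have h2 : g ^ 2 * 1 ≤ g ^ 2 * (Λ₁ * C₀sq) := mul_le_mul_of_nonneg_left h1 (sq_nonneg g)
    have e : Λ₁ * g ^ 2 * C₀sq = g ^ 2 * (Λ₁ * C₀sq) := by ring
    rw [e]; linarith only [h2]
  have hσ₀δ : g ^ 2 / C₀sq ≤ δ₀ / 64 := hσ₀σ₁.trans hσ₁δ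
  -- `K_H ≤ 1`
  obtain ⟨KH, hKH⟩ : ∃ KH : ℝ, KH = 2048 * Real.exp (1 / 16) * (θ * CA) / Real.pi ^ 2 + W / R₀ ^ 4 :=
    ⟨_, rfl⟩
  have hKHa : 2048 * Real.exp (1 / 16) * (θ * CA) / Real.pi ^ 2 = CA / (2 * (CA + 1)) := by
    have hene : Real.exp (1 / 16) ≠ 0 := (Real.exp_pos _).ne'
    have hπne : Real.pi ≠ 0 := hπ.ne'
    rw [hθ]; field_simp; ring
  have hKH1 : KH ≤ 1 := by
    rw [hKH, hKHa]
    have h1 : CA / (2 * (CA + 1)) ≤ 1 / 2 := by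
      rw [div_le_div_iff₀ (by positivity) two_pos]; linarith only [hCA]
    have h2 : W / R₀ ^ 4 ≤ 1 / 2 := by
      rw [div_le_iff₀ (by positivity)]; rw [hW₀] at hWW; linarith only [hWW]
    linarith only [h1, h2]
  have hKH0 : 0 ≤ KH := by rw [hKH]; positivity
  have hsqrt : Real.sqrt (Λ₁ * g ^ 2) = 16 * g / δ₀ := by
    have hδne : δ₀ ≠ 0 := hδ₀.ne'
    have : Λ₁ * g ^ 2 = (16 * g / δ₀) ^ 2 := by rw [hΛ₁]; field_simp; ring
    rw [this, Real.sqrt_sq (by positivity)]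
  rw [← hKH]
  refine ⟨hσ₀σ₁, hρR, hσ₁τ, param_hm hδ₀ hδ₁ hη hΛ₁ hg, ?_, param_ha hδ₀ hδ₁ hKH0 hKH1 hCG hC₀sq hg hσ₀δ,
    param_hK hδ₀ hKH0 hKH1 hCG hc₁ hc₂ hC₀0 hKρ1 hκ0 hΛ₁0 hg hσ₁δ hsqrt hKa hKb hκa ?_ ?_ hgc⟩
  · -- hE
    have := Real.one_sub_le_exp_neg (4 * (Λ₁ * g ^ 2))
    linarith only [this, hσ₁δ]
  · exact hξle _ (by rw [hDξ]; linarith only [hp1, hp3])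
  · exact hξle _ (by rw [hDξ]; linarith only [hp1, hp2])

end Summit.SmoothPoincare4.SmoothPoincare4.Cruxes.CylinderRungTwo.KillingFlux

end
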